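import Literature.NumberTheory.DiophantineGeometry.MasserWustholzIsogenyTheorem
import Literature.NumberTheory.DiophantineGeometry.AVIsogenySymmProofs
import Literature.AlgebraicGeometry.Motives.FaltingsFinitenessI
import Literature.AlgebraicGeometry.Motives.FaltingsFinitenessIDimZeroProofs
import Literature.AlgebraicGeometry.Motives.AbelianVarietyDegreeGrowth
import Literature.AlgebraicGeometry.Motives.AbelianVarietyPoincareCompleteReducibility
import HarnessLib

/-!
# The qualitative Masser–Wüstholz isogeny theorem from Faltings' Finiteness I

The named fact `Literature.NumberTheory.DiophantineGeometry.exists_isogeny_kerRank_le_of_isIsogenous A`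
(`MasserWustholzIsogenyTheorem`; Masser–Wüstholz, *Factorization estimates for abelian varieties*,
Publ. Math. IHÉS 81 (1995), Theorem II, p. 6, in its qualitative rational form: for an abelian
variety `A` over a number field `K` there is ONE integer `N` such that every `B` admitting an
isogeny `B → A` over `K` is the target of an isogeny `A → B` over `K` of degree `≤ N`) is proved
here **from Faltings' Finiteness I**, the named fact
`Literature.AlgebraicGeometry.Motives.AbelianVariety.finite_isoClasses_isogenous A`
(`Motives/FaltingsFinitenessI`; Milne, *Abelian Varieties* (2008), Ch. IV, Thm. 1.1; Faltings,
Invent. Math. 73 (1983), §6, Satz 6):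

* `exists_isogeny_kerRank_le_of_forall_exists_iso` — over any field of characteristic `0`: if the
  abelian varieties isogenous to `A` fall into finitely many isomorphism classes, represented by a
  family `C : Fin n → AbelianVariety K`, then the degrees of suitable isogenies `A → B` onto all
  `B` isogenous to `A` are bounded;
* `exists_isogeny_kerRank_le_of_isIsogenous_of_finite_isoClasses_isogenous` — **Finiteness I
  implies the qualitative isogeny theorem** over a number field;
* `exists_isogeny_kerRank_le_of_isIsogenous_of_dim_eq_zero` — hence the fact holds
  **unconditionally in dimension `0`**, where Finiteness I is elementary
  (`finite_isoClasses_isogenous_of_dim_eq_zero`, `Motives/FaltingsFinitenessIDimZeroProofs`);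
* `exists_isogeny_kerRank_le_of_isIsogenous_of_isIsogenous` (with the primed variant and
  `exists_isogeny_kerRank_le_of_isIsogenous_iff_of_isIsogenous`) — the fact is a **property of
  the isogeny class**: if it holds for `A₀` and there is an isogeny `A → A₀` (or `A₀ → A`), it
  holds for `A`, the bound being multiplied by the degree of that one isogeny.  This is the
  qualitative form of the last step of the printed proof (loc. cit., §7, p. 22, (7.5)–(7.6):
  Theorem II for `A` is obtained from a fixed isogeny `f : A → A₀` onto a product variety and the
  small isogenies `f* : A* → A₀` of Lemma 7.1, "now we can reverse `f*` and compose the result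
  with `f`").

## The argument

This is the remark "Conversely Finiteness I implies this qualitative form (one isogeny per
representative)" of the module docstring of `MasserWustholzIsogenyTheorem`, and historically the
order of events (Faltings 1983 precedes the effective isogeny estimates of Masser–Wüstholz
1993/1995, whose §1, p. 6, recalls "there are up to isomorphism over `k` only finitely many
abelian varieties defined over a number field of bounded degree with bounded dimension and bounded
height").  Given the representatives `C i`, choose for each `i` with `C i` isogenous to `A` an
isogeny `gᵢ : A → C i` — isogeny is a symmetric relation in characteristic `0`
(`IsIsogenous.symm_of_charZero`, Mumford §19, Remark p. 169) — and put `N = supᵢ deg gᵢ`.  If `B`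
is isogenous to `A` and `e : B ≅ C i`, then `gᵢ ≫ e⁻¹ : A → B` is an isogeny (`isIsogeny_comp`,
`isIsogeny_hom_of_iso`) of degree `deg gᵢ ≤ N`, because degrees `Hom.kerRank` are multiplicative
along isogenies (`IsIsogeny.kerRank_comp`, Milne 1986, §8) and an isomorphism has degree `1`
(`kerRank_id`).

## Why not the printed proof

The discharge `exists_isogeny_kerRank_le_of_isIsogenous_holds` is NOT in this file: it needs
either `finite_isoClasses_isogenous_holds` (Faltings' theorem, not in the tree) or the printed
proof of Masser–Wüstholz, loc. cit., §7 (pp. 21–23), whose ingredients are all absent from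
Mathlib and `Literature/`: the semistable Faltings height `h(A)` of an abelian variety, the dual
abelian variety and polarisations (Zarhin's trick `Z(A) = (A × Â)⁴`, Lemma 7.1), the polarised
isogeny estimate (7.1) of Masser–Wüstholz, Math. Z. 215 (1994), resting on the Period Theorem of
Ann. of Math. 137 (1993), 407–458 (transcendence on group varieties), and the discriminant /
class-index estimates of §§2–6 (a quantitative Jordan–Zassenhaus theorem).  With this file the two
named facts `finite_isoClasses_isogenous` and `exists_isogeny_kerRank_le_of_isIsogenous` are
formally equivalent over number fields (the converse direction, Finiteness I from the isogeny
bound by counting kernels inside `A[N!]`, lives with its consumer on the summit side).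

## References

* [MasserWustholz1995] D. W. Masser, G. Wüstholz, *Factorization estimates for abelian
  varieties*, Publ. Math. IHÉS 81 (1995), 5–24: Theorem II (p. 6), §7 (pp. 21–23) (held:
  `paper:doi-10-1007-bf02699374`, read).
* [MilneAV2008] J. S. Milne, *Abelian Varieties* (v2.00, 2008), Ch. IV, Thm. 1.1 (Finiteness I).
* [Faltings1983Endlichkeit] G. Faltings, Invent. Math. 73 (1983), 349–366, §6, Satz 6.
* [MumfordAV1970] D. Mumford, *Abelian Varieties*, §19, Remark p. 169 (symmetry of isogeny).
* [Milne1986AbelianVarieties] J. S. Milne, *Abelian Varieties*, in Cornell–Silverman (1986), §8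
  (degrees are multiplicative).

## Design

Pure-proof file: no definitions, no new named facts (D-0026).  Namespace = directory
(`Literature.NumberTheory.DiophantineGeometry`); the two degree lemmas for isomorphisms are
dot-notation extensions `IsIsogeny.kerRank_comp_hom_of_iso` / `IsIsogeny.kerRank_comp_inv_of_iso`
declared with their absolute names in `Literature.AlgebraicGeometry.Motives.AbelianVariety`, next to
`IsIsogeny.kerRank_comp`.  The family version is stated over any field of characteristic `0`
(all that symmetry of isogeny needs); the number field enters only through Finiteness I.
-/

noncomputable section

universe u

open CategoryTheory

namespace Literature.NumberTheory.DiophantineGeometry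

open Literature.AlgebraicGeometry.Motives (AbelianVariety)
open Literature.AlgebraicGeometry.Motives.AbelianVariety

variable {K : Type u} [Field K]

/-! ### Isomorphisms do not change degrees -/

/-- An isomorphism `e : B ≅ C` of abelian varieties has degree `1`, `Hom.kerRank e.hom = 1`:
`deg e⁻¹ · deg e = deg (e⁻¹ ≫ e) = deg 𝟙 = 1` by multiplicativity of degrees along isogenies
(`IsIsogeny.kerRank_comp`, Milne 1986, §8, p. 115) and `kerRank_id`. [folklore] -/
theorem _root_.Literature.AlgebraicGeometry.Motives.AbelianVariety.kerRank_hom_of_iso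
    {B C : AbelianVariety K} (e : B ≅ C) : Hom.kerRank e.hom = 1 := by
  have h := (isIsogeny_hom_of_iso e.symm).kerRank_comp (isIsogeny_hom_of_iso e)
  rw [Iso.symm_hom, e.inv_hom_id, kerRank_id] at h
  exact Nat.eq_one_of_mul_eq_one_left h.symm

/-- Composing an isogeny with an isomorphism does not change its degree:
`deg (f ≫ e) = deg f` (`IsIsogeny.kerRank_comp` and `kerRank_hom_of_iso`). [folklore] -/
theorem _root_.Literature.AlgebraicGeometry.Motives.AbelianVariety.IsIsogeny.kerRank_comp_hom_of_iso
    {A B C : AbelianVariety K} {f : A ⟶ B} (hf : IsIsogeny f) (e : B ≅ C) :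
    Hom.kerRank (f ≫ e.hom) = Hom.kerRank f := by
  rw [hf.kerRank_comp (isIsogeny_hom_of_iso e), kerRank_hom_of_iso, mul_one]

/-- Composing an isogeny with the inverse of an isomorphism does not change its degree:
`deg (f ≫ e⁻¹) = deg f`. [folklore] -/
theorem _root_.Literature.AlgebraicGeometry.Motives.AbelianVariety.IsIsogeny.kerRank_comp_inv_of_iso
    {A B C : AbelianVariety K} {f : A ⟶ C} (hf : IsIsogeny f) (e : B ≅ C) :
    Hom.kerRank (f ≫ e.inv) = Hom.kerRank f :=
  hf.kerRank_comp_hom_of_iso e.symm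

/-! ### Finitely many isomorphism classes give a uniform degree bound -/

/-- **Finitely many isomorphism classes in the isogeny class ⇒ bounded isogeny degrees.** Over a
field `K` of characteristic `0`, let `A` be an abelian variety and `C : Fin n → AbelianVariety K` a
family such that every `B` admitting an isogeny `B → A` is isomorphic to some `C i`.  Then there is
`N` such that every such `B` is the target of an isogeny `g : A → B` with `Hom.kerRank g ≤ N`: one
isogeny `gᵢ : A → C i` per representative isogenous to `A` (isogeny is symmetric in characteristic
`0`, `IsIsogenous.symm_of_charZero`, Mumford §19, Remark p. 169), `N = supᵢ deg gᵢ`, and for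
`e : B ≅ C i` the composite `gᵢ ≫ e⁻¹` is an isogeny of degree `deg gᵢ`
(`IsIsogeny.kerRank_comp_inv_of_iso`). [folklore] -/
theorem exists_isogeny_kerRank_le_of_forall_exists_iso [CharZero K] {A : AbelianVariety K} {n : ℕ}
    (C : Fin n → AbelianVariety K)
    (hC : ∀ B : AbelianVariety K, IsIsogenous B A → ∃ i, Nonempty (B ≅ C i)) :
    ∃ N : ℕ, ∀ B : AbelianVariety K, IsIsogenous B A →
      ∃ g : A ⟶ B, IsIsogeny g ∧ Hom.kerRank g ≤ N := by
  -- for each representative `C i`: a bound `N i` valid whenever `C i` is isogenous to `A`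
  have key : ∀ i : Fin n, ∃ N : ℕ, IsIsogenous (C i) A →
      ∃ g : A ⟶ C i, IsIsogeny g ∧ Hom.kerRank g ≤ N := fun i ↦ by
    by_cases h : IsIsogenous (C i) A
    · obtain ⟨g, hg⟩ := IsIsogenous.symm_of_charZero h
      exact ⟨Hom.kerRank g, fun _ ↦ ⟨g, hg, le_rfl⟩⟩
    · exact ⟨0, fun h' ↦ absurd h' h⟩
  choose N hN using key
  refine ⟨Finset.univ.sup N, fun B hB ↦ ?_⟩
  -- `B ≅ C i` for some representative, which is then isogenous to `A`
  obtain ⟨i, ⟨e⟩⟩ := hC B hB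
  have hi : IsIsogenous (C i) A :=
    hB.elim fun f hf ↦ ⟨e.inv ≫ f, isIsogeny_comp (isIsogeny_hom_of_iso e.symm) hf⟩
  obtain ⟨g, hg, hle⟩ := hN i hi
  refine ⟨g ≫ e.inv, isIsogeny_comp hg (isIsogeny_hom_of_iso e.symm), ?_⟩
  calc Hom.kerRank (g ≫ e.inv) = Hom.kerRank g := hg.kerRank_comp_inv_of_iso e
    _ ≤ N i := hle
    _ ≤ Finset.univ.sup N := Finset.le_sup (Finset.mem_univ i)

/-! ### Finiteness I implies the qualitative isogeny theorem -/

/-- **Faltings' Finiteness I implies the qualitative Masser–Wüstholz isogeny theorem.** For an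
abelian variety `A` over a field `K`: if, whenever `K` is a number field, the abelian varieties
over `K` isogenous to `A` fall into finitely many isomorphism classes
(`finite_isoClasses_isogenous A`, Milne, *Abelian Varieties* (2008), IV Thm. 1.1; Faltings 1983,
Satz 6), then, whenever `K` is a number field, there is `N` such that every `B` admitting an
isogeny `B → A` is the target of an isogeny `A → B` of degree `Hom.kerRank ≤ N`
(`exists_isogeny_kerRank_le_of_isIsogenous A`, the qualitative rational case of Masser–Wüstholz,
Publ. Math. IHÉS 81 (1995), Theorem II, p. 6) — by
`exists_isogeny_kerRank_le_of_forall_exists_iso`, number fields having characteristic `0`.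
[cite: MasserWustholz1995, Theorem II (p. 6)] -/
theorem exists_isogeny_kerRank_le_of_isIsogenous_of_finite_isoClasses_isogenous
    (A : AbelianVariety K) (h : finite_isoClasses_isogenous A) :
    exists_isogeny_kerRank_le_of_isIsogenous A := by
  intro hK
  obtain ⟨n, C, hC⟩ := h
  exact exists_isogeny_kerRank_le_of_forall_exists_iso C hC

/-! ### The unconditional case of dimension zero -/

/-- **The qualitative isogeny theorem in dimension `0`, unconditionally.** For an abelian variety
`A` of dimension `0` over any field the fact `exists_isogeny_kerRank_le_of_isIsogenous A` holds:
Finiteness I is elementary in dimension `0` (the isogeny class of `A` is the single isomorphism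
class of the zero abelian variety, `finite_isoClasses_isogenous_of_dim_eq_zero`), and Finiteness I
implies the fact (`exists_isogeny_kerRank_le_of_isIsogenous_of_finite_isoClasses_isogenous`).
Masser–Wüstholz state Theorem II for `n ≥ 1` only; this closes the degenerate case of the tree's
statement. [folklore] -/
theorem exists_isogeny_kerRank_le_of_isIsogenous_of_dim_eq_zero (A : AbelianVariety K)
    (hA : A.dim = 0) : exists_isogeny_kerRank_le_of_isIsogenous A :=
  exists_isogeny_kerRank_le_of_isIsogenous_of_finite_isoClasses_isogenous A
    (finite_isoClasses_isogenous_of_dim_eq_zero A hA)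

/-! ### The fact is a property of the isogeny class -/

/-- **Transport along an isogeny `A → A₀`** (the shape of Masser–Wüstholz, loc. cit., §7, p. 22,
(7.5)–(7.6): a fixed isogeny `f : A → A₀` and, for every `B` isogenous to `A`, a small isogeny
`A₀ → B`; "compose the result with `f`").  If every `B` admitting an isogeny `B → A₀` is the
target of an isogeny `A₀ → B` of degree `≤ N`, and `f : A → A₀` is an isogeny, then every `B`
admitting an isogeny `B → A` (hence `B → A → A₀`, `IsIsogenous.trans`) is the target of the
isogeny `f ≫ g : A → B` of degree `deg f · deg g ≤ deg f · N` (`IsIsogeny.kerRank_comp`, Milne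
1986, §8). [cite: MasserWustholz1995, §7 p. 22, (7.5)–(7.6)] -/
theorem exists_isogeny_kerRank_le_of_isIsogenous_of_isIsogenous {A A₀ : AbelianVariety K}
    (h₀ : exists_isogeny_kerRank_le_of_isIsogenous A₀) (hA : IsIsogenous A A₀) :
    exists_isogeny_kerRank_le_of_isIsogenous A := by
  intro hK
  obtain ⟨N, hN⟩ := h₀
  obtain ⟨f, hf⟩ := hA
  refine ⟨Hom.kerRank f * N, fun B hB ↦ ?_⟩
  obtain ⟨g, hg, hle⟩ := hN B (hB.trans ⟨f, hf⟩)
  refine ⟨f ≫ g, isIsogeny_comp hf hg, ?_⟩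
  rw [hf.kerRank_comp hg]
  exact Nat.mul_le_mul_left _ hle

/-- **Transport along an isogeny `A₀ → A`.** The same with the fixed isogeny in the direction
`A₀ → A`: over a number field (characteristic `0`) isogeny is a symmetric relation
(`IsIsogenous.symm_of_charZero`, Mumford §19, Remark p. 169), which reverses it.
[cite: MasserWustholz1995, §7 p. 22, (7.5)–(7.6)] -/
theorem exists_isogeny_kerRank_le_of_isIsogenous_of_isIsogenous' {A A₀ : AbelianVariety K}
    (h₀ : exists_isogeny_kerRank_le_of_isIsogenous A₀) (hA : IsIsogenous A₀ A) :
    exists_isogeny_kerRank_le_of_isIsogenous A := by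
  intro hK
  exact exists_isogeny_kerRank_le_of_isIsogenous_of_isIsogenous h₀
    (IsIsogenous.symm_of_charZero hA)

/-- **The qualitative isogeny theorem is an invariant of the isogeny class**: for isogenous
abelian varieties `A`, `A₀` over a field, `exists_isogeny_kerRank_le_of_isIsogenous A` holds iff
`exists_isogeny_kerRank_le_of_isIsogenous A₀` does (transport in both directions; the symmetry of
isogeny needed for one of them is available because the fact speaks about number fields only).
In particular the fact for `A` reduces to the fact for any product variety
`A₀ = A₁^{e₁} × ⋯ × A_k^{e_k}` isogenous to `A`, the case treated by Masser–Wüstholz's Lemma 7.1.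
[cite: MasserWustholz1995, §7 p. 22, (7.5)–(7.6)] -/
theorem exists_isogeny_kerRank_le_of_isIsogenous_iff_of_isIsogenous {A A₀ : AbelianVariety K}
    (hA : IsIsogenous A A₀) :
    exists_isogeny_kerRank_le_of_isIsogenous A ↔ exists_isogeny_kerRank_le_of_isIsogenous A₀ :=
  ⟨fun h ↦ exists_isogeny_kerRank_le_of_isIsogenous_of_isIsogenous' h hA,
    fun h ↦ exists_isogeny_kerRank_le_of_isIsogenous_of_isIsogenous h hA⟩

end Literature.NumberTheory.DiophantineGeometry

end
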